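import Summits.QuantumFields.BalabanUV.Beta.NVertexEvenBorder
import Summits.QuantumFields.BalabanUV.Beta.GAN24.WrecAtEvenHalfRows

/-!
# `BalabanUV.Beta.NVertexEvenCarrier` — row D1 ∕ (C1), PART 21: **THE EVEN N-FAMILY IS an1's CARRIER AT ZERO FIRST-ORDER TABLES** —
# `WN♮ μ y ν y′ = W2SymOfK (AN R j) (Lc^(j+1)) 0 0 T2_Nᵉ M2_Nᵉ μ y ν y′` (the response word is gone on EVERY block), and **ON THE FIELD–FIELD BLOCK IT IS THE
# WILSON BI-VERTEX OVER THE EVEN WILSON BI-STENCIL (weight `cE₂`) PLUS THE TWO MIXED WORDS** — the right side of v5's second-order H-row `hHN₂` has THREE sectors, not four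

WHY.  v5 (`FP/StepRecursionFeedNestedNamedD`) binds the order-2 Hessian slot `H₂f` by `hHN₂ : ½•(H′₂f (dv a) (dv a′) + sym) = (perF T (dper T (wound WN♮)))|ff`.  Road FP g44
A-5 ∕ Q-FP-44-2 (journal l.67846) proposed to DISPLAY `H₂f := (perF T (dper T 𝒱₂(v,v′)))|ff` with `𝒱₂ = Σ_b Σ_{b′} hb hb′ · 𝒯₂ᵉ + Σ_b Σ_β (hb·hm′ + hb′·hm) · ℳ₂ᵉ` and NO
response data, and asked the row to confirm.  PART 19 `NVertexEvenBorder.WN_evenHalf_eq` (GAN24 `evenHalf_W2SymOfK` at the N record) is block-independent: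
`WN♮ = W2SymOfK (chart) N S_N Mt_N T2_Nᵉ M2_Nᵉ − ½•(resp + resp_swapped)`; lit `W2OfK_apply` puts the same two response words INSIDE `W2SymOfK`, so they cancel
identically and `WN♮` is an1's symmetrised carrier with the FIRST-order tables set to ZERO (§1–§2: the response word `dM (K2OfK K N 0 0 ·) N 0 0 ·` of that carrier is the
zero kernel — GAN24 `vertexOfK_zero_table ∕ vertexOfM_zero_table`).  This closed form is the device by which PART 16∕17's generic parents
(`CombHId2W2SymSwap.dper_tsum_W2SymOfK_translate`, `CombHId2TorusSym.perF_W2SymOfK_slots ∕ perF_W2OfK_slots`, `CombHId2FoldsSlots`) periodise and read the EVEN family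
word by word with the sockets `S := 0, Mt := 0` (PART 22∕23).  On the `(inl α, inl β)` entries (§3): `T2_N = cE₂•wilsonW₂ + cB•compB` (`T2RecOf_zero_level`,
`tabsComp_vh₂S`) and `compB = atw ∘ compVh2Sˢ` VANISHES on the field–field block in BOTH orientations (`atw`'s `(inl, inl) ↦ 0`, `rfl`), so the even bi-vertex table reads
`cE₂ · W₂ᵉ`, `W₂ᵉ := ½•(wilsonW₂ + sgnK (trK wilsonW₂))` — the EVEN HALF of the Wilson bi-stencil (for the free position table `Pn.T` the tree asserts no transpose
symmetry of lit `wEntry₂`, so the half is kept); the mixed tables `M2_Nᵉ = wM2 • compMixᵉ` are field–field and SURVIVE; hence (§4) **`WN_evenHalf_apply_inl_inl`**: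
`WN♮ μ y ν y′ x z (inl α) (inl β) = cE₂ · ½(vertex2OfK (AN) N W₂ᵉ μ y ν y′ + vertex2OfK (AN) N W₂ᵉ ν y′ μ y) x z (inl α) (inl β) + (mixOfK (AN) N M2_Nᵉ μ y ν y′
+ mixOfK (AN) N M2_Nᵉ ν y′ μ y) x z (inl α) (inl β)` — Q-FP-44-2 CONFIRMED with the precision `𝒯₂ᵉ = cE₂ • W₂ᵉ` (J-NOTE-12; J-NOTE-10 §2's response sector withdrawn).

WHAT ([folklore] bookkeeping BY NAME; no `def`, no `def … : Prop`, nothing cited, 0 sorry): §1 generic `dM_zero_zero`, `W2OfK_zero_first`, `W2SymOfK_zero_first`,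
`W2SymOfK_zero_first_apply`; §2 **`WN_evenHalf_eq_W2SymOfK_zero`**, `WN_evenHalf_eq_sectors`; §3 `compB_apply_inl_inl`, `T2N_even_apply_inl_inl` (∕ `′` on lit `wEntry₂`),
`M2N_even_apply_inl_inl`, `vertex2OfK_T2N_even_apply_inl_inl`; §4 **`WN_evenHalf_apply_inl_inl`**.
WHAT THIS IS NOT: not the periodised ∕ torus reading (PART 22∕23); not the H-side word `H₂f` (the road's display) nor its junction; not the locks' values; nothing of
Bałaban's asserted, valued or discharged; 0 estimates; 0∕4 row-D1 binders (hW, hR, D1Tel, D1Rep); ROOT M‴ p325680 ∕ P5c ∕ D6 untouched; NOT (C1), NOT (T-ID), NOT D1,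
NEVER «G-an2-4 closed», NOT BetaPertH, NOT continuum, NOT Clay.

HONEST DEPENDENCY (page 1, mandatory): continuum YM on T⁴ ⇐ BetaPertH ∧ nine spine estimates (0/9 proved); BetaPertH ⇐ (D1) ∧ (D4) ∧ CAP+tail;
G-an2-4 gates asym, D1 and NE2/3/4.  HONEST FRAMING (cell contract, verbatim): «discharging `BetaPertH` makes Bałaban's UV stability UNCONDITIONAL —
a real constructive-QFT result; it is NOT the continuum limit and NOT the Clay problem.»  ABSOLUTE RULE (cell charter, verbatim): «No internally-minted
statement may enter as a cited fact. Every hypothesis is either kernel-proved in this package or a verbatim quotation of a PUBLISHED theorem with page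
reference. The manuscript(s) under audit are NOT citable for their own disputed steps — they are the thing under adjudication; programme-internal
(2001/route/tribunal) claims are never citable.»  Row D1 ∕ (C1) OWNER an2 (b2b-balaban-beta-an2) gen 69, 2026-08-27.  No existing file touched.
-/

noncomputable section

open scoped BigOperators

namespace Summit.QuantumFields.BalabanUV.Beta.NVertexEvenCarrier

open Literature.MathematicalPhysics.QuantumFieldTheory
open Literature.MathematicalPhysics.QuantumFieldTheory.Balaban1983to89
open Literature.MathematicalPhysics.QuantumFieldTheory.Balaban1983to89.Beta
open ExpKernelCalculus (MKer)
open AffineAveraging (Site box toSite)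
open OneStepResolventKernel (Fib)
open OneStepKernelFamily (vertexOfK)
open BalabanStepW2 (M2Of wM2)
open WilsonBiStencil (wilsonW₂ wEntry₂ wilsonW₂_inl_inl)
open SecondOrderResponse (vertexOfM dM K2OfK vertex2OfK mixOfK W2OfK W2SymOfK W2OfK_apply)
open Summit.QuantumFields.BalabanUV.Beta.TameKernelCalculus (trK trK_apply)
open Summit.QuantumFields.BalabanUV.Beta.BorderedHessian (sgnF sgnF_inl sgnF_inr sgnK sgnK_apply)
open Summit.QuantumFields.BalabanUV.Beta.AxialDressingRooted (one_le_of_neZero)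
open Summit.QuantumFields.BalabanUV.Beta.SpineRooted (SpureRecOf T2RecOf T2RecOf_zero_level)
open Summit.QuantumFields.BalabanUV.Beta.SymAveragingHessianCounts (symLinKerAt symVhKerAt)
open Summit.QuantumFields.BalabanUV.Beta.CompositeVertexKernelRec (compVh2S)
open Summit.QuantumFields.BalabanUV.Beta.CompositeVertexKernelBoundsTwoSym (symVh2KerSymAt)
open Summit.QuantumFields.BalabanUV.Beta.CompositeCorrectorDress (compChart)
open Summit.QuantumFields.BalabanUV.Beta.CompositeOneShotJets (compB compMix tabsComp tabsComp_vh₂S tabsComp_mixFF)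
open Summit.QuantumFields.BalabanUV.Beta.CompositeOneShotJetData (Roots Pins AN AN_eq WN)
open Summit.QuantumFields.BalabanUV.Beta.GAN24.SecondOrderReadersParity (vertex2OfK_smul' mixOfK_smul)
open Summit.QuantumFields.BalabanUV.Beta.GAN24.T2RecursionAffine (vertexOfK_zero_table)
open Summit.QuantumFields.BalabanUV.Beta.GAN24.WrecAtEvenHalfRows (vertexOfM_zero_table)
open Summit.QuantumFields.BalabanUV.Beta.NVertexEvenBorder (WN_evenHalf_eq vertex2OfK_apply_congr)

/-! ## §1 an1's carrier at zero first-order tables has no response word (generic) -/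

section Generic

variable {d : ℕ} (K : MKer (d + 1) (Fib d)) (N : ℕ) [NeZero N]
  (S₂ M₂ : Fin (d + 1) → (Fin (d + 1) → ℤ) → Fin (d + 1) → (Fin (d + 1) → ℤ) → MKer (d + 1) (Fib d))

/-- [folklore] The operator derivative along ZERO first-order tables is the zero kernel, whatever the column kernel:
`dM K N 0 0 μ y = 0` (GAN24 `vertexOfK_zero_table` + `vertexOfM_zero_table`). -/
theorem dM_zero_zero (μ : Fin (d + 1)) (y : Fin (d + 1) → ℤ) :
    dM K N (0 : Fin (d + 1) → (Fin (d + 1) → ℤ) → MKer (d + 1) (Fib d)) (0 : Fin (d + 1) → (Fin (d + 1) → ℤ) → MKer (d + 1) (Fib d)) μ y = 0 := by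
  show vertexOfK K N 0 μ y + vertexOfM K N 0 μ y = 0
  rw [vertexOfK_zero_table, vertexOfM_zero_table, add_zero]

/-- [folklore] **`W2OfK` AT ZERO FIRST-ORDER TABLES IS THE BI-VERTEX PLUS THE TWO MIXED WORDS** (lit `W2OfK_apply`; the response word `dM (K2OfK K N 0 0 b′) N 0 0 b` vanishes). -/
theorem W2OfK_zero_first (μ : Fin (d + 1)) (y : Fin (d + 1) → ℤ) (ν : Fin (d + 1)) (y' : Fin (d + 1) → ℤ) :
    W2OfK K N (0 : Fin (d + 1) → (Fin (d + 1) → ℤ) → MKer (d + 1) (Fib d)) (0 : Fin (d + 1) → (Fin (d + 1) → ℤ) → MKer (d + 1) (Fib d)) S₂ M₂ μ y ν y'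
      = vertex2OfK K N S₂ μ y ν y' + mixOfK K N M₂ μ y ν y' + mixOfK K N M₂ ν y' μ y := by
  rw [W2OfK_apply, dM_zero_zero, add_zero]

/-- [folklore] **`W2SymOfK` AT ZERO FIRST-ORDER TABLES**: `= ½•(vertex2OfK S₂ b b′ + vertex2OfK S₂ b′ b) + (mixOfK M₂ b b′ + mixOfK M₂ b′ b)` (the two mixed words each appear in
both orientations, so they carry weight one). -/
theorem W2SymOfK_zero_first (μ : Fin (d + 1)) (y : Fin (d + 1) → ℤ) (ν : Fin (d + 1)) (y' : Fin (d + 1) → ℤ) :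
    W2SymOfK K N (0 : Fin (d + 1) → (Fin (d + 1) → ℤ) → MKer (d + 1) (Fib d)) (0 : Fin (d + 1) → (Fin (d + 1) → ℤ) → MKer (d + 1) (Fib d)) S₂ M₂ μ y ν y'
      = (1 / 2 : ℝ) • (vertex2OfK K N S₂ μ y ν y' + vertex2OfK K N S₂ ν y' μ y) + (mixOfK K N M₂ μ y ν y' + mixOfK K N M₂ ν y' μ y) := by
  unfold W2SymOfK
  rw [W2OfK_zero_first, W2OfK_zero_first]
  funext x z a b
  simp only [Pi.add_apply, Pi.smul_apply, smul_eq_mul]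
  ring

/-- [folklore] The same, read at an entry. -/
theorem W2SymOfK_zero_first_apply (μ : Fin (d + 1)) (y : Fin (d + 1) → ℤ) (ν : Fin (d + 1)) (y' : Fin (d + 1) → ℤ) (x z : Fin (d + 1) → ℤ) (a b : Fib d) :
    W2SymOfK K N (0 : Fin (d + 1) → (Fin (d + 1) → ℤ) → MKer (d + 1) (Fib d)) (0 : Fin (d + 1) → (Fin (d + 1) → ℤ) → MKer (d + 1) (Fib d)) S₂ M₂ μ y ν y' x z a b
      = (1 / 2 : ℝ) * (vertex2OfK K N S₂ μ y ν y' x z a b + vertex2OfK K N S₂ ν y' μ y x z a b)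
        + (mixOfK K N M₂ μ y ν y' x z a b + mixOfK K N M₂ ν y' μ y x z a b) := by
  rw [W2SymOfK_zero_first]
  simp only [Pi.add_apply, Pi.smul_apply, smul_eq_mul]

end Generic

variable {Lc : ℕ} [NeZero Lc] (R : Roots Lc) (P : Pins) (j : ℕ)

/-! ## §2 The even N-family in closed form: the carrier at zero first-order tables over the even second-order tables -/

section Closed

/-- [folklore] **`WN_evenHalf_eq_W2SymOfK_zero` — THE EVEN HALF OF THE N-SYSTEM's SECOND-ORDER FAMILY IS an1's SYMMETRISED CARRIER THROUGH THE N-CHART AT ZERO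
FIRST-ORDER TABLES OVER THE EVEN HALVES `T2_Nᵉ ∕ M2_Nᵉ`** (PART 19 `WN_evenHalf_eq`; the response words inside and outside `W2SymOfK` cancel — lit `W2OfK_apply`, §1). -/
theorem WN_evenHalf_eq_W2SymOfK_zero (μ : Fin (3 + 1)) (y : Fin (3 + 1) → ℤ) (ν : Fin (3 + 1)) (y' : Fin (3 + 1) → ℤ) :
    (1 / 2 : ℝ) • (WN R P j μ y ν y' + sgnK (trK (WN R P j μ y ν y')))
      = W2SymOfK (AN R j) (Lc ^ (j + 1)) (0 : Fin (3 + 1) → (Fin (3 + 1) → ℤ) → MKer (3 + 1) (Fib 3)) (0 : Fin (3 + 1) → (Fin (3 + 1) → ℤ) → MKer (3 + 1) (Fib 3))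
          (fun κ u κ' u' => (1 / 2 : ℝ) • (T2RecOf 3 (Lc ^ (j + 1)) (fun _ => compChart R.rc Lc (j + 1) (R.s (j + 1)) (Lc ^ (j + 1)))
        (SpureRecOf 3 (Lc ^ (j + 1)) (tabsComp (j + 1) (one_le_of_neZero Lc) R.hr (P.cM (j + 1))).V
        (tabsComp (j + 1) (one_le_of_neZero Lc) R.hr (P.cM (j + 1))).H (fun _ => compChart R.rc Lc (j + 1) (R.s (j + 1)) (Lc ^ (j + 1)))
        (P.cE (j + 1)) (P.cVH (j + 1)) (P.cΛ (j + 1)))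
        (tabsComp (j + 1) (one_le_of_neZero Lc) R.hr (P.cM (j + 1))).M (P.cE₂ (j + 1)) (P.cB (j + 1)) (P.T (j + 1))
        (tabsComp (j + 1) (one_le_of_neZero Lc) R.hr (P.cM (j + 1))).vh₂S (tabsComp (j + 1) (one_le_of_neZero Lc) R.hr (P.cM (j + 1))).mixFF 0 κ u κ' u'
          + sgnK (trK (T2RecOf 3 (Lc ^ (j + 1)) (fun _ => compChart R.rc Lc (j + 1) (R.s (j + 1)) (Lc ^ (j + 1)))
        (SpureRecOf 3 (Lc ^ (j + 1)) (tabsComp (j + 1) (one_le_of_neZero Lc) R.hr (P.cM (j + 1))).V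
        (tabsComp (j + 1) (one_le_of_neZero Lc) R.hr (P.cM (j + 1))).H (fun _ => compChart R.rc Lc (j + 1) (R.s (j + 1)) (Lc ^ (j + 1)))
        (P.cE (j + 1)) (P.cVH (j + 1)) (P.cΛ (j + 1)))
        (tabsComp (j + 1) (one_le_of_neZero Lc) R.hr (P.cM (j + 1))).M (P.cE₂ (j + 1)) (P.cB (j + 1)) (P.T (j + 1))
        (tabsComp (j + 1) (one_le_of_neZero Lc) R.hr (P.cM (j + 1))).vh₂S (tabsComp (j + 1) (one_le_of_neZero Lc) R.hr (P.cM (j + 1))).mixFF 0 κ u κ' u'))))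
          (fun κ u ρ w => (1 / 2 : ℝ) • (M2Of 3 (Lc ^ (j + 1)) (tabsComp (j + 1) (one_le_of_neZero Lc) R.hr (P.cM (j + 1))).mixFF 0 κ u ρ w + sgnK (trK (M2Of 3 (Lc ^ (j + 1)) (tabsComp (j + 1) (one_le_of_neZero Lc) R.hr (P.cM (j + 1))).mixFF 0 κ u ρ w)))) μ y ν y' := by
  rw [WN_evenHalf_eq R P j μ y ν y', AN_eq, W2SymOfK_zero_first]
  unfold W2SymOfK
  rw [W2OfK_apply, W2OfK_apply]
  funext x z a b
  simp only [Pi.add_apply, Pi.sub_apply, Pi.smul_apply, smul_eq_mul]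
  ring

/-- [folklore] **`WN_evenHalf_eq_sectors`** — the same with the carrier opened: `WN♮ b b′ = ½•(vertex2OfK (AN) N T2_Nᵉ b b′ + vertex2OfK (AN) N T2_Nᵉ b′ b) + (mixOfK (AN) N M2_Nᵉ b b′
+ mixOfK (AN) N M2_Nᵉ b′ b)` — the bi-vertex sector and the two mixed sectors, NO response sector, on every block. -/
theorem WN_evenHalf_eq_sectors (μ : Fin (3 + 1)) (y : Fin (3 + 1) → ℤ) (ν : Fin (3 + 1)) (y' : Fin (3 + 1) → ℤ) :
    (1 / 2 : ℝ) • (WN R P j μ y ν y' + sgnK (trK (WN R P j μ y ν y')))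
      = (1 / 2 : ℝ) • (vertex2OfK (AN R j) (Lc ^ (j + 1)) (fun κ u κ' u' => (1 / 2 : ℝ) • (T2RecOf 3 (Lc ^ (j + 1)) (fun _ => compChart R.rc Lc (j + 1) (R.s (j + 1)) (Lc ^ (j + 1)))
        (SpureRecOf 3 (Lc ^ (j + 1)) (tabsComp (j + 1) (one_le_of_neZero Lc) R.hr (P.cM (j + 1))).V
        (tabsComp (j + 1) (one_le_of_neZero Lc) R.hr (P.cM (j + 1))).H (fun _ => compChart R.rc Lc (j + 1) (R.s (j + 1)) (Lc ^ (j + 1)))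
        (P.cE (j + 1)) (P.cVH (j + 1)) (P.cΛ (j + 1)))
        (tabsComp (j + 1) (one_le_of_neZero Lc) R.hr (P.cM (j + 1))).M (P.cE₂ (j + 1)) (P.cB (j + 1)) (P.T (j + 1))
        (tabsComp (j + 1) (one_le_of_neZero Lc) R.hr (P.cM (j + 1))).vh₂S (tabsComp (j + 1) (one_le_of_neZero Lc) R.hr (P.cM (j + 1))).mixFF 0 κ u κ' u'
          + sgnK (trK (T2RecOf 3 (Lc ^ (j + 1)) (fun _ => compChart R.rc Lc (j + 1) (R.s (j + 1)) (Lc ^ (j + 1)))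
        (SpureRecOf 3 (Lc ^ (j + 1)) (tabsComp (j + 1) (one_le_of_neZero Lc) R.hr (P.cM (j + 1))).V
        (tabsComp (j + 1) (one_le_of_neZero Lc) R.hr (P.cM (j + 1))).H (fun _ => compChart R.rc Lc (j + 1) (R.s (j + 1)) (Lc ^ (j + 1)))
        (P.cE (j + 1)) (P.cVH (j + 1)) (P.cΛ (j + 1)))
        (tabsComp (j + 1) (one_le_of_neZero Lc) R.hr (P.cM (j + 1))).M (P.cE₂ (j + 1)) (P.cB (j + 1)) (P.T (j + 1))
        (tabsComp (j + 1) (one_le_of_neZero Lc) R.hr (P.cM (j + 1))).vh₂S (tabsComp (j + 1) (one_le_of_neZero Lc) R.hr (P.cM (j + 1))).mixFF 0 κ u κ' u')))) μ y ν y'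
          + vertex2OfK (AN R j) (Lc ^ (j + 1)) (fun κ u κ' u' => (1 / 2 : ℝ) • (T2RecOf 3 (Lc ^ (j + 1)) (fun _ => compChart R.rc Lc (j + 1) (R.s (j + 1)) (Lc ^ (j + 1)))
        (SpureRecOf 3 (Lc ^ (j + 1)) (tabsComp (j + 1) (one_le_of_neZero Lc) R.hr (P.cM (j + 1))).V
        (tabsComp (j + 1) (one_le_of_neZero Lc) R.hr (P.cM (j + 1))).H (fun _ => compChart R.rc Lc (j + 1) (R.s (j + 1)) (Lc ^ (j + 1)))
        (P.cE (j + 1)) (P.cVH (j + 1)) (P.cΛ (j + 1)))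
        (tabsComp (j + 1) (one_le_of_neZero Lc) R.hr (P.cM (j + 1))).M (P.cE₂ (j + 1)) (P.cB (j + 1)) (P.T (j + 1))
        (tabsComp (j + 1) (one_le_of_neZero Lc) R.hr (P.cM (j + 1))).vh₂S (tabsComp (j + 1) (one_le_of_neZero Lc) R.hr (P.cM (j + 1))).mixFF 0 κ u κ' u'
          + sgnK (trK (T2RecOf 3 (Lc ^ (j + 1)) (fun _ => compChart R.rc Lc (j + 1) (R.s (j + 1)) (Lc ^ (j + 1)))
        (SpureRecOf 3 (Lc ^ (j + 1)) (tabsComp (j + 1) (one_le_of_neZero Lc) R.hr (P.cM (j + 1))).V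
        (tabsComp (j + 1) (one_le_of_neZero Lc) R.hr (P.cM (j + 1))).H (fun _ => compChart R.rc Lc (j + 1) (R.s (j + 1)) (Lc ^ (j + 1)))
        (P.cE (j + 1)) (P.cVH (j + 1)) (P.cΛ (j + 1)))
        (tabsComp (j + 1) (one_le_of_neZero Lc) R.hr (P.cM (j + 1))).M (P.cE₂ (j + 1)) (P.cB (j + 1)) (P.T (j + 1))
        (tabsComp (j + 1) (one_le_of_neZero Lc) R.hr (P.cM (j + 1))).vh₂S (tabsComp (j + 1) (one_le_of_neZero Lc) R.hr (P.cM (j + 1))).mixFF 0 κ u κ' u')))) ν y' μ y)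
        + (mixOfK (AN R j) (Lc ^ (j + 1)) (fun κ u ρ w => (1 / 2 : ℝ) • (M2Of 3 (Lc ^ (j + 1)) (tabsComp (j + 1) (one_le_of_neZero Lc) R.hr (P.cM (j + 1))).mixFF 0 κ u ρ w + sgnK (trK (M2Of 3 (Lc ^ (j + 1)) (tabsComp (j + 1) (one_le_of_neZero Lc) R.hr (P.cM (j + 1))).mixFF 0 κ u ρ w)))) μ y ν y'
          + mixOfK (AN R j) (Lc ^ (j + 1)) (fun κ u ρ w => (1 / 2 : ℝ) • (M2Of 3 (Lc ^ (j + 1)) (tabsComp (j + 1) (one_le_of_neZero Lc) R.hr (P.cM (j + 1))).mixFF 0 κ u ρ w + sgnK (trK (M2Of 3 (Lc ^ (j + 1)) (tabsComp (j + 1) (one_le_of_neZero Lc) R.hr (P.cM (j + 1))).mixFF 0 κ u ρ w)))) ν y' μ y) := by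
  rw [WN_evenHalf_eq_W2SymOfK_zero, W2SymOfK_zero_first]

end Closed

/-! ## §3 The field–field block of the even second-order tables -/

section Block

/-- [folklore] `compB = atw ∘ compVh2Sˢ` VANISHES on the field–field block (`atw`'s `(inl, inl) ↦ 0`, `rfl`). -/
theorem compB_apply_inl_inl (r : Fin (3 + 1) → ℕ) (L m : ℕ) (κ : Fin (3 + 1)) (u : Site (3 + 1)) (κ' : Fin (3 + 1)) (u' x z : Site (3 + 1)) (α β : Fin (3 + 1)) :
    compB r L m κ u κ' u' x z (Sum.inl α) (Sum.inl β) = 0 := rfl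

/-- [folklore] **the even half of `T2_N` on `(inl, inl)` is `cE₂ ·` the even half of the Wilson bi-stencil** (`T2RecOf_zero_level`: `T2_N = cE₂•wilsonW₂ + cB•compB`; `compB|ff = 0` in
both orientations). -/
theorem T2N_even_apply_inl_inl (κ : Fin (3 + 1)) (u : Fin (3 + 1) → ℤ) (κ' : Fin (3 + 1)) (u' x z : Fin (3 + 1) → ℤ) (α β : Fin (3 + 1)) :
    ((1 / 2 : ℝ) • (T2RecOf 3 (Lc ^ (j + 1)) (fun _ => compChart R.rc Lc (j + 1) (R.s (j + 1)) (Lc ^ (j + 1)))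
        (SpureRecOf 3 (Lc ^ (j + 1)) (tabsComp (j + 1) (one_le_of_neZero Lc) R.hr (P.cM (j + 1))).V
        (tabsComp (j + 1) (one_le_of_neZero Lc) R.hr (P.cM (j + 1))).H (fun _ => compChart R.rc Lc (j + 1) (R.s (j + 1)) (Lc ^ (j + 1)))
        (P.cE (j + 1)) (P.cVH (j + 1)) (P.cΛ (j + 1)))
        (tabsComp (j + 1) (one_le_of_neZero Lc) R.hr (P.cM (j + 1))).M (P.cE₂ (j + 1)) (P.cB (j + 1)) (P.T (j + 1))
        (tabsComp (j + 1) (one_le_of_neZero Lc) R.hr (P.cM (j + 1))).vh₂S (tabsComp (j + 1) (one_le_of_neZero Lc) R.hr (P.cM (j + 1))).mixFF 0 κ u κ' u'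
          + sgnK (trK (T2RecOf 3 (Lc ^ (j + 1)) (fun _ => compChart R.rc Lc (j + 1) (R.s (j + 1)) (Lc ^ (j + 1)))
        (SpureRecOf 3 (Lc ^ (j + 1)) (tabsComp (j + 1) (one_le_of_neZero Lc) R.hr (P.cM (j + 1))).V
        (tabsComp (j + 1) (one_le_of_neZero Lc) R.hr (P.cM (j + 1))).H (fun _ => compChart R.rc Lc (j + 1) (R.s (j + 1)) (Lc ^ (j + 1)))
        (P.cE (j + 1)) (P.cVH (j + 1)) (P.cΛ (j + 1)))
        (tabsComp (j + 1) (one_le_of_neZero Lc) R.hr (P.cM (j + 1))).M (P.cE₂ (j + 1)) (P.cB (j + 1)) (P.T (j + 1))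
        (tabsComp (j + 1) (one_le_of_neZero Lc) R.hr (P.cM (j + 1))).vh₂S (tabsComp (j + 1) (one_le_of_neZero Lc) R.hr (P.cM (j + 1))).mixFF 0 κ u κ' u')))) x z (Sum.inl α) (Sum.inl β)
      = P.cE₂ (j + 1) * ((1 / 2 : ℝ) • (wilsonW₂ 3 (P.T (j + 1)) κ u κ' u' + sgnK (trK (wilsonW₂ 3 (P.T (j + 1)) κ u κ' u')))) x z (Sum.inl α) (Sum.inl β) := by
  simp only [T2RecOf_zero_level, tabsComp_vh₂S, Pi.smul_apply, Pi.add_apply, smul_eq_mul, sgnK_apply, trK_apply, sgnF_inl, compB_apply_inl_inl]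
  ring

/-- [folklore] the same on lit `wEntry₂`: `T2_Nᵉ κ u κ′ u′ x z (inl α) (inl β) = cE₂ · ½(wEntry₂ T κ u κ′ u′ x z α β + wEntry₂ T κ u κ′ u′ z x β α)` (`wilsonW₂_inl_inl`). -/
theorem T2N_even_apply_inl_inl' (κ : Fin (3 + 1)) (u : Fin (3 + 1) → ℤ) (κ' : Fin (3 + 1)) (u' x z : Fin (3 + 1) → ℤ) (α β : Fin (3 + 1)) :
    ((1 / 2 : ℝ) • (T2RecOf 3 (Lc ^ (j + 1)) (fun _ => compChart R.rc Lc (j + 1) (R.s (j + 1)) (Lc ^ (j + 1)))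
        (SpureRecOf 3 (Lc ^ (j + 1)) (tabsComp (j + 1) (one_le_of_neZero Lc) R.hr (P.cM (j + 1))).V
        (tabsComp (j + 1) (one_le_of_neZero Lc) R.hr (P.cM (j + 1))).H (fun _ => compChart R.rc Lc (j + 1) (R.s (j + 1)) (Lc ^ (j + 1)))
        (P.cE (j + 1)) (P.cVH (j + 1)) (P.cΛ (j + 1)))
        (tabsComp (j + 1) (one_le_of_neZero Lc) R.hr (P.cM (j + 1))).M (P.cE₂ (j + 1)) (P.cB (j + 1)) (P.T (j + 1))
        (tabsComp (j + 1) (one_le_of_neZero Lc) R.hr (P.cM (j + 1))).vh₂S (tabsComp (j + 1) (one_le_of_neZero Lc) R.hr (P.cM (j + 1))).mixFF 0 κ u κ' u'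
          + sgnK (trK (T2RecOf 3 (Lc ^ (j + 1)) (fun _ => compChart R.rc Lc (j + 1) (R.s (j + 1)) (Lc ^ (j + 1)))
        (SpureRecOf 3 (Lc ^ (j + 1)) (tabsComp (j + 1) (one_le_of_neZero Lc) R.hr (P.cM (j + 1))).V
        (tabsComp (j + 1) (one_le_of_neZero Lc) R.hr (P.cM (j + 1))).H (fun _ => compChart R.rc Lc (j + 1) (R.s (j + 1)) (Lc ^ (j + 1)))
        (P.cE (j + 1)) (P.cVH (j + 1)) (P.cΛ (j + 1)))
        (tabsComp (j + 1) (one_le_of_neZero Lc) R.hr (P.cM (j + 1))).M (P.cE₂ (j + 1)) (P.cB (j + 1)) (P.T (j + 1))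
        (tabsComp (j + 1) (one_le_of_neZero Lc) R.hr (P.cM (j + 1))).vh₂S (tabsComp (j + 1) (one_le_of_neZero Lc) R.hr (P.cM (j + 1))).mixFF 0 κ u κ' u')))) x z (Sum.inl α) (Sum.inl β)
      = P.cE₂ (j + 1) * ((1 / 2 : ℝ) * (wEntry₂ 3 (P.T (j + 1)) κ u κ' u' x z α β + wEntry₂ 3 (P.T (j + 1)) κ u κ' u' z x β α)) := by
  rw [T2N_even_apply_inl_inl]
  simp only [Pi.smul_apply, Pi.add_apply, smul_eq_mul, sgnK_apply, trK_apply, sgnF_inl, wilsonW₂_inl_inl, one_mul]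

/-- [folklore] **the even half of `M2_N` on `(inl, inl)`** is `wM2 · ½(compMix + compMix-transposed)` there — the composite mixed table is field–field and SURVIVES
(`M2Of = wM2 • mixFF`, `tabsComp_mixFF`). -/
theorem M2N_even_apply_inl_inl (κ : Fin (3 + 1)) (u : Fin (3 + 1) → ℤ) (ρ : Fin (3 + 1)) (w x z : Fin (3 + 1) → ℤ) (α β : Fin (3 + 1)) :
    ((1 / 2 : ℝ) • (M2Of 3 (Lc ^ (j + 1)) (tabsComp (j + 1) (one_le_of_neZero Lc) R.hr (P.cM (j + 1))).mixFF 0 κ u ρ w + sgnK (trK (M2Of 3 (Lc ^ (j + 1)) (tabsComp (j + 1) (one_le_of_neZero Lc) R.hr (P.cM (j + 1))).mixFF 0 κ u ρ w)))) x z (Sum.inl α) (Sum.inl β)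
      = wM2 3 (Lc ^ (j + 1)) 0 * ((1 / 2 : ℝ) * (compMix R.r Lc (j + 1) κ u ρ w x z (Sum.inl α) (Sum.inl β) + compMix R.r Lc (j + 1) κ u ρ w z x (Sum.inl β) (Sum.inl α))) := by
  simp only [M2Of, tabsComp_mixFF, Pi.smul_apply, Pi.add_apply, smul_eq_mul, sgnK_apply, trK_apply, sgnF_inl, one_mul]
  ring

/-- [folklore] **the bi-vertex over `T2_Nᵉ` on `(inl, inl)` is `cE₂ ·` the bi-vertex over `W₂ᵉ`** (PART 19 `vertex2OfK_apply_congr` + GAN24 `vertex2OfK_smul′`). -/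
theorem vertex2OfK_T2N_even_apply_inl_inl (μ : Fin (3 + 1)) (y : Fin (3 + 1) → ℤ) (ν : Fin (3 + 1)) (y' x z : Fin (3 + 1) → ℤ) (α β : Fin (3 + 1)) :
    vertex2OfK (AN R j) (Lc ^ (j + 1)) (fun κ u κ' u' => (1 / 2 : ℝ) • (T2RecOf 3 (Lc ^ (j + 1)) (fun _ => compChart R.rc Lc (j + 1) (R.s (j + 1)) (Lc ^ (j + 1)))
        (SpureRecOf 3 (Lc ^ (j + 1)) (tabsComp (j + 1) (one_le_of_neZero Lc) R.hr (P.cM (j + 1))).V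
        (tabsComp (j + 1) (one_le_of_neZero Lc) R.hr (P.cM (j + 1))).H (fun _ => compChart R.rc Lc (j + 1) (R.s (j + 1)) (Lc ^ (j + 1)))
        (P.cE (j + 1)) (P.cVH (j + 1)) (P.cΛ (j + 1)))
        (tabsComp (j + 1) (one_le_of_neZero Lc) R.hr (P.cM (j + 1))).M (P.cE₂ (j + 1)) (P.cB (j + 1)) (P.T (j + 1))
        (tabsComp (j + 1) (one_le_of_neZero Lc) R.hr (P.cM (j + 1))).vh₂S (tabsComp (j + 1) (one_le_of_neZero Lc) R.hr (P.cM (j + 1))).mixFF 0 κ u κ' u'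
          + sgnK (trK (T2RecOf 3 (Lc ^ (j + 1)) (fun _ => compChart R.rc Lc (j + 1) (R.s (j + 1)) (Lc ^ (j + 1)))
        (SpureRecOf 3 (Lc ^ (j + 1)) (tabsComp (j + 1) (one_le_of_neZero Lc) R.hr (P.cM (j + 1))).V
        (tabsComp (j + 1) (one_le_of_neZero Lc) R.hr (P.cM (j + 1))).H (fun _ => compChart R.rc Lc (j + 1) (R.s (j + 1)) (Lc ^ (j + 1)))
        (P.cE (j + 1)) (P.cVH (j + 1)) (P.cΛ (j + 1)))
        (tabsComp (j + 1) (one_le_of_neZero Lc) R.hr (P.cM (j + 1))).M (P.cE₂ (j + 1)) (P.cB (j + 1)) (P.T (j + 1))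
        (tabsComp (j + 1) (one_le_of_neZero Lc) R.hr (P.cM (j + 1))).vh₂S (tabsComp (j + 1) (one_le_of_neZero Lc) R.hr (P.cM (j + 1))).mixFF 0 κ u κ' u')))) μ y ν y' x z (Sum.inl α) (Sum.inl β)
      = P.cE₂ (j + 1) * vertex2OfK (AN R j) (Lc ^ (j + 1)) (fun κ u κ' u' => (1 / 2 : ℝ) • (wilsonW₂ 3 (P.T (j + 1)) κ u κ' u' + sgnK (trK (wilsonW₂ 3 (P.T (j + 1)) κ u κ' u')))) μ y ν y' x z (Sum.inl α) (Sum.inl β) := by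
  rw [vertex2OfK_apply_congr _ _ (S₂' := fun κ u κ' u' => (P.cE₂ (j + 1)) • ((1 / 2 : ℝ) • (wilsonW₂ 3 (P.T (j + 1)) κ u κ' u' + sgnK (trK (wilsonW₂ 3 (P.T (j + 1)) κ u κ' u')))))
      (fun κ u κ' u' x z => by rw [T2N_even_apply_inl_inl R P j]; simp only [Pi.smul_apply, smul_eq_mul]) μ y ν y' x z,
    vertex2OfK_smul']
  simp only [Pi.smul_apply, smul_eq_mul]

end Block

/-! ## §4 The even N-family on the field–field block: the Wilson bi-vertex sector and the two mixed sectors -/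

section FF

/-- [folklore] **`WN_evenHalf_apply_inl_inl` — ON THE FIELD–FIELD BLOCK THE EVEN N-FAMILY IS `cE₂ ·` THE SYMMETRISED WILSON BI-VERTEX OVER `W₂ᵉ` PLUS THE TWO MIXED WORDS OVER
`M2_Nᵉ`** (§2 at the entry + §3): `WN♮ μ y ν y′ x z (inl α) (inl β) = cE₂ · ½(vertex2OfK (AN) N W₂ᵉ μ y ν y′ + vertex2OfK (AN) N W₂ᵉ ν y′ μ y) x z (inl α) (inl β)
+ (mixOfK (AN) N M2_Nᵉ μ y ν y′ + mixOfK (AN) N M2_Nᵉ ν y′ μ y) x z (inl α) (inl β)`.  No Λ-Hessian table, no border table, no response word. -/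
theorem WN_evenHalf_apply_inl_inl (μ : Fin (3 + 1)) (y : Fin (3 + 1) → ℤ) (ν : Fin (3 + 1)) (y' x z : Fin (3 + 1) → ℤ) (α β : Fin (3 + 1)) :
    ((1 / 2 : ℝ) • (WN R P j μ y ν y' + sgnK (trK (WN R P j μ y ν y')))) x z (Sum.inl α) (Sum.inl β)
      = P.cE₂ (j + 1) * ((1 / 2 : ℝ) * (vertex2OfK (AN R j) (Lc ^ (j + 1)) (fun κ u κ' u' => (1 / 2 : ℝ) • (wilsonW₂ 3 (P.T (j + 1)) κ u κ' u' + sgnK (trK (wilsonW₂ 3 (P.T (j + 1)) κ u κ' u')))) μ y ν y' x z (Sum.inl α) (Sum.inl β)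
          + vertex2OfK (AN R j) (Lc ^ (j + 1)) (fun κ u κ' u' => (1 / 2 : ℝ) • (wilsonW₂ 3 (P.T (j + 1)) κ u κ' u' + sgnK (trK (wilsonW₂ 3 (P.T (j + 1)) κ u κ' u')))) ν y' μ y x z (Sum.inl α) (Sum.inl β)))
        + (mixOfK (AN R j) (Lc ^ (j + 1)) (fun κ u ρ w => (1 / 2 : ℝ) • (M2Of 3 (Lc ^ (j + 1)) (tabsComp (j + 1) (one_le_of_neZero Lc) R.hr (P.cM (j + 1))).mixFF 0 κ u ρ w + sgnK (trK (M2Of 3 (Lc ^ (j + 1)) (tabsComp (j + 1) (one_le_of_neZero Lc) R.hr (P.cM (j + 1))).mixFF 0 κ u ρ w)))) μ y ν y' x z (Sum.inl α) (Sum.inl β)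
          + mixOfK (AN R j) (Lc ^ (j + 1)) (fun κ u ρ w => (1 / 2 : ℝ) • (M2Of 3 (Lc ^ (j + 1)) (tabsComp (j + 1) (one_le_of_neZero Lc) R.hr (P.cM (j + 1))).mixFF 0 κ u ρ w + sgnK (trK (M2Of 3 (Lc ^ (j + 1)) (tabsComp (j + 1) (one_le_of_neZero Lc) R.hr (P.cM (j + 1))).mixFF 0 κ u ρ w)))) ν y' μ y x z (Sum.inl α) (Sum.inl β)) := by
  rw [WN_evenHalf_eq_W2SymOfK_zero, W2SymOfK_zero_first_apply, vertex2OfK_T2N_even_apply_inl_inl, vertex2OfK_T2N_even_apply_inl_inl]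
  ring

end FF

end Summit.QuantumFields.BalabanUV.Beta.NVertexEvenCarrier

end
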